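import Literature.NumberTheory.Transcendental.MultipleZetaStuffle
import Mathlib.Analysis.SpecialFunctions.Pow.Real

/-!
# `MzvKernelInKZ` (stmt-KontsevichZagierPeriods-3914), line two-posets-interior-landen:
# labelled quasi-shuffles and the stuffle identity of cubical generating functions

Stub `stub_stuffleComb` of the lead's skeleton (a registered sub-goal of `stub_stuffleProduct`,
crux `LinRedNormalForm.MzvKernelInKZ`): the list combinatorics and the finite field algebra of the
harmonic ("stuffle") product inside the KZ calculus, on which the lead builds the move chain of the
stuffle product of two cubical MZV representations.

Definitions (shared verbatim with the lead, who consumes `StuffleComb`):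

* `qsh op u v`, the LABELLED quasi-shuffle of two lists over a type with a merge operation `op`,
  by Hoffman's front recursion (A1)–(A3) (M. E. Hoffman, *The algebra of multiple harmonic
  series*, J. Algebra 194 (1997), §2): the tree's `MZV.stuffle` is the instance `α = ℕ`,
  `op = (+)` (`stuffle_eq_qsh`); with `α = List (Fin n)`, `op = (++)` a pattern
  `π ∈ qsh (++) S T` records WHICH cube coordinates are merged;
* `blockProd z B = ∏_{i ∈ B} z i` and the cubical generating function with prefix `c`,
  `gfun z c [B₁,…,B_r] = ∏ᵢ (c X₁⋯Xᵢ)/(1 − c X₁⋯Xᵢ)`, `Xᵢ = blockProd z Bᵢ`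
  (`= ∑_{n₁>⋯>n_r≥1} c^{n₁} ∏ Xᵢ^{nᵢ}`; `gfun z 1 (blocks of s)` is, up to the product of all
  coordinates, the cubical integrand of `ζ(s)`, cf. Hoffman 1997, §3);
* `StuffleComb`, the conjunction of the five statements proved here.

Results: (1) `MZV.stuffle = qsh (+)`; (2) `qsh` commutes with merge-homomorphisms (`map_qsh`);
(3) every pattern of `qsh (++) S T` is, flattened, a permutation of `S.flatten ++ T.flatten`
(`flatten_perm_of_mem_qsh`); (4) non-empty blocks stay non-empty (`ne_nil_of_mem_qsh`);
(5) THE STUFFLE IDENTITY `G(S)·G(T) = ∑_{π ∈ S ∗ T} G(π)` for `G = gfun z 1` on the open unit cube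
(`gfun_mul_gfun`). The proof of (5) is Hoffman's induction on `ℓ(S) + ℓ(T)` run from the BACK:
`qsh` also satisfies the back recursion up to permutation (`qsh_concat_concat_perm`, nine-block
bookkeeping), appending a last block multiplies `G` by `C/(1 − C)` with `C` the total coordinate
product (`gfun_concat`), the total product of a pattern is that of `S` and `T`
(`blockProd_flatten_of_mem_qsh`), and the three terms of the back recursion are the three terms of
the partial-fraction identity `a/(1−a) · b/(1−b) = ab/(1−ab) · (a/(1−a) + b/(1−b) + 1)`
(`three_term`; all products lie in `(0,1)`, so no denominator vanishes).

Everything is self-contained finite algebra: no measure theory, no limits. Imports: the tree's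
`MultipleZetaStuffle` (for `MZV.stuffle` and its functional induction) and Mathlib.
-/

namespace Summit.KontsevichZagierPeriods.MzvKernelInKZ.TwoPosets

open Literature.NumberTheory.Transcendental

/-- The labelled quasi-shuffle ("stuffle") of two lists over a type with a merge operation `op`,
by Hoffman's front recursion (A1)–(A3): `[] ∗ v = [v]`, `(a∷u) ∗ [] = [a∷u]`,
`(a∷u) ∗ (b∷v) = a(u ∗ bv) + b(au ∗ v) + (op a b)(u ∗ v)` — the same recursion as the tree's
`MZV.stuffle` (the instance `α = ℕ`, `op = (+)`); with `α = List (Fin n)`, `op = (++)` its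
elements record WHICH cube coordinates are merged (Hoffman 1997, §2). -/
def qsh {α : Type*} (op : α → α → α) : List α → List α → List (List α)
  | [], v => [v]
  | a :: u, [] => [a :: u]
  | a :: u, b :: v =>
      (qsh op u (b :: v)).map (List.cons a) ++
        ((qsh op (a :: u) v).map (List.cons b) ++ (qsh op u v).map (List.cons (op a b)))
termination_by u v => u.length + v.length

/-- The product of the coordinates of a block. -/
def blockProd {n : ℕ} (z : Fin n → ℝ) (B : List (Fin n)) : ℝ := (B.map z).prod

/-- The cubical generating function of a chain of blocks with prefix `c`:
`gfun z c [B₁,…,B_r] = ∏ᵢ (c·X₁⋯Xᵢ)/(1 − c·X₁⋯Xᵢ)`, `Xᵢ = blockProd z Bᵢ`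
(`= ∑_{n₁>⋯>n_r≥1} c^{n₁} ∏ Xᵢ^{nᵢ}` for `0 < c·X < 1`); `gfun z 1 (blocks of s)` is
`(∏ all coordinates) ×` the cubical integrand of `ζ(s)`. -/
noncomputable def gfun {n : ℕ} (z : Fin n → ℝ) : ℝ → List (List (Fin n)) → ℝ
  | _, [] => 1
  | c, B :: p => (c * blockProd z B) / (1 - c * blockProd z B) * gfun z (c * blockProd z B) p

/-- The combinatorics and algebra of the stuffle inside the calculus (registered stub
`stub_stuffleComb`, consumed by the lead's `stub_stuffleProduct`): (1) the tree's stuffle is the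
`ℕ`-instance of `qsh`; (2) `qsh` commutes with merge-homomorphisms; (3) every pattern of
`qsh (++) S T` uses every coordinate of `S` and `T` exactly once; (4) non-empty blocks stay
non-empty; (5) THE STUFFLE IDENTITY of cubical generating functions on the open cube:
`G(S)·G(T) = ∑_{π ∈ S ∗ T} G(π)` (three-term partial fractions
`1/((1−A)(1−B)) = A/((1−A)(1−AB)) + B/((1−B)(1−AB)) + 1/(1−AB)`, recursing on the LAST blocks). -/
def StuffleComb : Prop :=
  (∀ s t : List ℕ, MZV.stuffle s t = qsh (· + ·) s t) ∧
  (∀ {α β : Type} (op : α → α → α) (op' : β → β → β) (f : α → β),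
    (∀ a b, f (op a b) = op' (f a) (f b)) →
      ∀ u v : List α, (qsh op u v).map (List.map f) = qsh op' (u.map f) (v.map f)) ∧
  (∀ {n : ℕ} (S T : List (List (Fin n))), ∀ π ∈ qsh (· ++ ·) S T,
    π.flatten.Perm (S.flatten ++ T.flatten)) ∧
  (∀ {n : ℕ} (S T : List (List (Fin n))), (∀ B ∈ S, B ≠ []) → (∀ B ∈ T, B ≠ []) →
    ∀ π ∈ qsh (· ++ ·) S T, ∀ B ∈ π, B ≠ []) ∧
  (∀ {n : ℕ} (z : Fin n → ℝ), (∀ i, 0 < z i ∧ z i < 1) →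
    ∀ S T : List (List (Fin n)), (∀ B ∈ S, B ≠ []) → (∀ B ∈ T, B ≠ []) →
      gfun z 1 S * gfun z 1 T = ((qsh (· ++ ·) S T).map (gfun z 1)).sum)

/-! ### The front recursion of `qsh` and the four combinatorial statements -/

section Qsh

variable {α β : Type*}

/-- Rule (A1): `[] ∗ v = [v]`. -/
@[simp] theorem qsh_nil_left (op : α → α → α) (v : List α) : qsh op [] v = [v] := qsh.eq_1 op v

/-- Rule (A1), second clause of the definition: `(a∷u) ∗ [] = [a∷u]`. -/
@[simp] theorem qsh_cons_nil (op : α → α → α) (a : α) (u : List α) :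
    qsh op (a :: u) [] = [a :: u] := qsh.eq_2 op a u

/-- Rule (A1): `u ∗ [] = [u]`. -/
@[simp] theorem qsh_nil_right (op : α → α → α) (u : List α) : qsh op u [] = [u] := by
  cases u <;> simp

/-- Rule (A3), the front recursion: `(a∷u) ∗ (b∷v) = a(u ∗ bv) + b(au ∗ v) + (op a b)(u ∗ v)`. -/
theorem qsh_cons_cons (op : α → α → α) (a : α) (u : List α) (b : α) (v : List α) :
    qsh op (a :: u) (b :: v) =
      (qsh op u (b :: v)).map (List.cons a) ++
        ((qsh op (a :: u) v).map (List.cons b) ++ (qsh op u v).map (List.cons (op a b))) :=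
  qsh.eq_3 op a u b v

/-- (1) The tree's harmonic product `MZV.stuffle` is the instance `op = (+)` of `qsh`. -/
theorem stuffle_eq_qsh (s t : List ℕ) : MZV.stuffle s t = qsh (· + ·) s t := by
  induction s, t using MZV.stuffle.induct with
  | case1 t => simp
  | case2 a s => simp
  | case3 a s b t ih1 ih2 ih3 => rw [MZV.stuffle_cons_cons, qsh_cons_cons, ih1, ih2, ih3]

/-- (2) `qsh` commutes with merge-homomorphisms: if `f (op a b) = op' (f a) (f b)` then
`map (map f) (qsh op u v) = qsh op' (map f u) (map f v)`. -/
theorem map_qsh (op : α → α → α) (op' : β → β → β) (f : α → β)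
    (hf : ∀ a b, f (op a b) = op' (f a) (f b)) (u v : List α) :
    (qsh op u v).map (List.map f) = qsh op' (u.map f) (v.map f) := by
  induction u, v using qsh.induct with
  | case1 v => simp
  | case2 a u => simp
  | case3 a u b v ih1 ih2 ih3 =>
    simp only [List.map_cons] at ih1 ih2 ⊢
    rw [qsh_cons_cons, qsh_cons_cons, ← ih1, ← ih2, ← ih3]
    simp [List.map_append, List.map_map, Function.comp_def, hf]

/-- (3) Coordinate conservation: every pattern of `qsh (++) S T`, flattened, is a permutation of
`S.flatten ++ T.flatten` (each coordinate of `S` and of `T` is used exactly once). -/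
theorem flatten_perm_of_mem_qsh (S T : List (List α)) :
    ∀ π ∈ qsh (· ++ ·) S T, π.flatten.Perm (S.flatten ++ T.flatten) := by
  induction S, T using qsh.induct with
  | case1 v =>
    intro π hπ
    rw [qsh_nil_left, List.mem_singleton] at hπ
    simp [hπ]
  | case2 a u =>
    intro π hπ
    rw [qsh_cons_nil, List.mem_singleton] at hπ
    simp [hπ]
  | case3 a u b v ih1 ih2 ih3 =>
    intro π hπ
    simp only [qsh_cons_cons, List.mem_append, List.mem_map] at hπ
    rcases hπ with ⟨π, hπ, rfl⟩ | ⟨π, hπ, rfl⟩ | ⟨π, hπ, rfl⟩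
    · have h := ih1 π hπ
      simp only [List.flatten_cons, List.append_assoc] at h ⊢
      exact h.append_left a
    · have h := ih2 π hπ
      simp only [List.flatten_cons, List.append_assoc] at h ⊢
      exact ((h.append_left b).trans (List.perm_append_comm_assoc b a _)).trans
        ((List.perm_append_comm_assoc b _ _).append_left a)
    · have h := ih3 π hπ
      simp only [List.flatten_cons, List.append_assoc] at h ⊢
      exact ((h.append_left b).trans (List.perm_append_comm_assoc b _ _)).append_left a

/-- (4) If all blocks of `S` and `T` are non-empty, so are all blocks of every pattern of
`qsh (++) S T`. -/
theorem ne_nil_of_mem_qsh (S T : List (List α)) (hS : ∀ B ∈ S, B ≠ []) (hT : ∀ B ∈ T, B ≠ []) :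
    ∀ π ∈ qsh (· ++ ·) S T, ∀ B ∈ π, B ≠ [] := by
  induction S, T using qsh.induct with
  | case1 v =>
    intro π hπ
    rw [qsh_nil_left, List.mem_singleton] at hπ
    subst hπ
    exact hT
  | case2 a u =>
    intro π hπ
    rw [qsh_cons_nil, List.mem_singleton] at hπ
    subst hπ
    exact hS
  | case3 a u b v ih1 ih2 ih3 =>
    intro π hπ
    have ha : a ≠ [] := hS a (by simp)
    have hb : b ≠ [] := hT b (by simp)
    have hu : ∀ B ∈ u, B ≠ [] := fun B hB => hS B (List.mem_cons_of_mem a hB)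
    have hv : ∀ B ∈ v, B ≠ [] := fun B hB => hT B (List.mem_cons_of_mem b hB)
    simp only [qsh_cons_cons, List.mem_append, List.mem_map] at hπ
    rcases hπ with ⟨π, hπ, rfl⟩ | ⟨π, hπ, rfl⟩ | ⟨π, hπ, rfl⟩
    · intro B hB
      rcases List.mem_cons.mp hB with rfl | hB
      exacts [ha, ih1 hu hT π hπ B hB]
    · intro B hB
      rcases List.mem_cons.mp hB with rfl | hB
      exacts [hb, ih2 hS hv π hπ B hB]
    · intro B hB
      rcases List.mem_cons.mp hB with rfl | hB
      exacts [List.append_ne_nil_of_left_ne_nil ha b, ih3 hu hv π hπ B hB]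

/-- The BACK recursion of the quasi-shuffle, up to permutation:
`ua ∗ vb ~ (u ∗ vb)a + (ua ∗ v)b + (u ∗ v)(op a b)` (the mirror image of Hoffman's rule (A3),
Hoffman 1997, §2). Proof: induction on `u`, `v`, unfolding the front recursion on both sides;
for `u = x∷u₁`, `v = y∷v₁` both sides consist of the same nine blocks. -/
theorem qsh_concat_concat_perm (op : α → α → α) (a b : α) (u v : List α) :
    (qsh op (u ++ [a]) (v ++ [b])).Perm
      ((qsh op u (v ++ [b])).map (· ++ [a]) ++
        ((qsh op (u ++ [a]) v).map (· ++ [b]) ++ (qsh op u v).map (· ++ [op a b]))) := by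
  induction u generalizing v with
  | nil =>
    induction v with
    | nil =>
      simp only [List.nil_append, qsh_cons_cons, qsh_nil_left, qsh_nil_right, List.map_cons,
        List.map_nil, List.cons_append]
      exact List.Perm.swap _ _ _
    | cons y v ihv =>
      simp only [List.nil_append, List.cons_append] at ihv ⊢
      rw [qsh_cons_cons]
      refine (((ihv.map (List.cons y)).append_right _).append_left _).trans ?_
      simp only [qsh_cons_cons, qsh_nil_left, List.map_append, List.map_map,
        Function.comp_def, List.map_cons, List.map_nil, List.cons_append, List.nil_append,
        List.append_assoc]
      rw [← Multiset.coe_eq_coe]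
      simp only [← Multiset.coe_add, ← Multiset.cons_coe, Multiset.coe_nil,
        ← Multiset.singleton_add]
      abel
  | cons x u ihu =>
    induction v with
    | nil =>
      have ih := ihu []
      simp only [List.nil_append, List.cons_append] at ih ⊢
      rw [qsh_cons_cons]
      refine ((ih.map (List.cons x)).append_right _).trans ?_
      simp only [qsh_cons_cons, qsh_nil_right, List.map_append, List.map_map,
        Function.comp_def, List.map_cons, List.map_nil, List.cons_append, List.nil_append,
        List.append_assoc]
      rw [← Multiset.coe_eq_coe]
      simp only [← Multiset.coe_add, ← Multiset.cons_coe, Multiset.coe_nil,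
        ← Multiset.singleton_add]
      abel
    | cons y v ihv =>
      have ih1 := ihu (y :: v)
      have ih3 := ihu v
      simp only [List.cons_append] at ih1 ihv ⊢
      rw [qsh_cons_cons]
      refine ((ih1.map (List.cons x)).append
        ((ihv.map (List.cons y)).append (ih3.map (List.cons (op x y))))).trans ?_
      simp only [qsh_cons_cons, List.map_append, List.map_map, Function.comp_def,
        List.cons_append, List.append_assoc]
      rw [← Multiset.coe_eq_coe]
      simp only [← Multiset.coe_add]
      abel

end Qsh

/-! ### Block products and the cubical generating functions -/

section Gfun

variable {n : ℕ}

/-- The generating function of the empty chain is `1`. -/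
@[simp] theorem gfun_nil (z : Fin n → ℝ) (c : ℝ) : gfun z c [] = 1 := gfun.eq_1 z c

/-- The empty block has product `1`. -/
@[simp] theorem blockProd_nil (z : Fin n → ℝ) : blockProd z [] = 1 := by simp [blockProd]

/-- `blockProd z (i∷B) = z i · blockProd z B`. -/
@[simp] theorem blockProd_cons (z : Fin n → ℝ) (i : Fin n) (B : List (Fin n)) :
    blockProd z (i :: B) = z i * blockProd z B := by simp [blockProd]

/-- `blockProd` is multiplicative under concatenation. -/
theorem blockProd_append (z : Fin n → ℝ) (A B : List (Fin n)) :
    blockProd z (A ++ B) = blockProd z A * blockProd z B := by simp [blockProd]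

/-- On the open unit cube every block product is positive. -/
theorem blockProd_pos {z : Fin n → ℝ} (hz : ∀ i, 0 < z i ∧ z i < 1) (B : List (Fin n)) :
    0 < blockProd z B := by
  induction B with
  | nil => simp
  | cons i B ih => rw [blockProd_cons]; exact mul_pos (hz i).1 ih

/-- On the open unit cube every block product is at most `1`. -/
theorem blockProd_le_one {z : Fin n → ℝ} (hz : ∀ i, 0 < z i ∧ z i < 1) (B : List (Fin n)) :
    blockProd z B ≤ 1 := by
  induction B with
  | nil => simp
  | cons i B ih => rw [blockProd_cons]; exact mul_le_one₀ (hz i).2.le (blockProd_pos hz B).le ih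

/-- On the open unit cube the product of a NON-EMPTY block is `< 1`. -/
theorem blockProd_lt_one {z : Fin n → ℝ} (hz : ∀ i, 0 < z i ∧ z i < 1) {B : List (Fin n)}
    (hB : B ≠ []) : blockProd z B < 1 := by
  obtain ⟨i, B, rfl⟩ := List.exists_cons_of_ne_nil hB
  rw [blockProd_cons]
  exact mul_lt_one_of_nonneg_of_lt_one_left (hz i).1.le (hz i).2 (blockProd_le_one hz B)

/-- Total product of a pattern: by coordinate conservation (3), the product of all coordinates of a
pattern `π ∈ qsh (++) S T` is the product of all coordinates of `S` times that of `T`. -/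
theorem blockProd_flatten_of_mem_qsh (z : Fin n → ℝ) {S T π : List (List (Fin n))}
    (h : π ∈ qsh (· ++ ·) S T) :
    blockProd z π.flatten = blockProd z S.flatten * blockProd z T.flatten := by
  rw [← blockProd_append]
  exact ((flatten_perm_of_mem_qsh S T π h).map z).prod_eq

/-- SNOC rule of the generating function: appending a last block `B` to a chain `p` multiplies
`gfun z c p` by `C/(1 − C)`, where `C = c · (product of all coordinates of p ++ [B])`. -/
theorem gfun_concat (z : Fin n → ℝ) (B : List (Fin n)) (p : List (List (Fin n))) (c : ℝ) :
    gfun z c (p ++ [B]) = gfun z c p *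
      (c * blockProd z (p ++ [B]).flatten / (1 - c * blockProd z (p ++ [B]).flatten)) := by
  induction p generalizing c with
  | nil => simp [gfun]
  | cons B' p ih =>
    simp only [List.cons_append, gfun, ih, List.flatten_cons, blockProd_append]
    ring

/-- Summing the snoc rule over a list of chains with a common total product `t` after appending
`C`: `∑_{π ∈ L} G(π ++ [C]) = (∑_{π ∈ L} G(π)) · t/(1 − t)` for `G = gfun z 1`. -/
theorem sum_map_gfun_concat (z : Fin n → ℝ) (L : List (List (List (Fin n)))) (C : List (Fin n))
    (t : ℝ) (h : ∀ π ∈ L, blockProd z (π ++ [C]).flatten = t) :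
    ((L.map (· ++ [C])).map (gfun z 1)).sum = (L.map (gfun z 1)).sum * (t / (1 - t)) := by
  rw [← List.sum_map_mul_right, List.map_map]
  refine congrArg List.sum (List.map_congr_left fun π hπ => ?_)
  rw [Function.comp_apply, gfun_concat, one_mul, h π hπ]

/-- The three-term partial-fraction identity behind the stuffle (Hoffman's three types of terms
`n > m`, `m > n`, `n = m` for geometric series):
`a/(1−a) · b/(1−b) = ab/(1−ab) · (a/(1−a) + b/(1−b) + 1)` for `a, b, ab < 1`. -/
theorem three_term {a b : ℝ} (ha : a < 1) (hb : b < 1) (hab : a * b < 1) :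
    a / (1 - a) * (b / (1 - b)) = a * b / (1 - a * b) * (a / (1 - a) + b / (1 - b) + 1) := by
  have ha' : 1 - a ≠ 0 := (sub_pos.mpr ha).ne'
  have hb' : 1 - b ≠ 0 := (sub_pos.mpr hb).ne'
  have hab' : 1 - a * b ≠ 0 := (sub_pos.mpr hab).ne'
  field_simp
  ring

/-- (5) THE STUFFLE IDENTITY of cubical generating functions: for `z` in the open unit cube and
chains `S`, `T` of non-empty blocks, `G(S) · G(T) = ∑_{π ∈ qsh (++) S T} G(π)` with `G = gfun z 1`.
Induction on `S`, `T` from the back (`List.reverseRecOn`): with `S = S' ++ [A]`,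
`T = T' ++ [B]`, `a = ∏_S z`, `b = ∏_T z`, the snoc rule gives
`G(S)G(T) = G(S')G(T') · a/(1−a) · b/(1−b)`, the three-term identity and the three induction
hypotheses turn this into `ab/(1−ab) · (∑_{S ∗ T'} G + ∑_{S' ∗ T} G + ∑_{S' ∗ T'} G)`, and since
every pattern has total product `∏_{S'} z · ∏_{T'} z`, the snoc rule read backwards and the back
recursion `qsh_concat_concat_perm` give `∑_{S ∗ T} G`. -/
theorem gfun_mul_gfun (z : Fin n → ℝ) (hz : ∀ i, 0 < z i ∧ z i < 1) (S : List (List (Fin n))) :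
    ∀ T : List (List (Fin n)), (∀ B ∈ S, B ≠ []) → (∀ B ∈ T, B ≠ []) →
      gfun z 1 S * gfun z 1 T = ((qsh (· ++ ·) S T).map (gfun z 1)).sum := by
  induction S using List.reverseRecOn with
  | nil => intro T _ _; simp
  | append_singleton S A ihS =>
    intro T hS
    induction T using List.reverseRecOn with
    | nil => intro _; simp
    | append_singleton T B ihT =>
      intro hT
      have hS' : ∀ B ∈ S, B ≠ [] := fun B hB => hS B (List.mem_append_left _ hB)
      have hT' : ∀ B ∈ T, B ≠ [] := fun B' hB => hT B' (List.mem_append_left _ hB)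
      have ha0 : 0 < blockProd z (S ++ [A]).flatten := blockProd_pos hz _
      have ha1 : blockProd z (S ++ [A]).flatten < 1 :=
        blockProd_lt_one hz (by simp [hS A (by simp)])
      have hb1 : blockProd z (T ++ [B]).flatten < 1 :=
        blockProd_lt_one hz (by simp [hT B (by simp)])
      have hab : blockProd z (S ++ [A]).flatten * blockProd z (T ++ [B]).flatten < 1 :=
        mul_lt_one_of_nonneg_of_lt_one_left ha0.le ha1 hb1.le
      have t1 : ∀ π ∈ qsh (· ++ ·) S (T ++ [B]), blockProd z (π ++ [A]).flatten =
          blockProd z (S ++ [A]).flatten * blockProd z (T ++ [B]).flatten := fun π hπ => by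
        simp only [List.flatten_append, List.flatten_cons, List.flatten_nil, List.append_nil,
          blockProd_append, blockProd_flatten_of_mem_qsh z hπ]
        ring
      have t2 : ∀ π ∈ qsh (· ++ ·) (S ++ [A]) T, blockProd z (π ++ [B]).flatten =
          blockProd z (S ++ [A]).flatten * blockProd z (T ++ [B]).flatten := fun π hπ => by
        simp only [List.flatten_append, List.flatten_cons, List.flatten_nil, List.append_nil,
          blockProd_append, blockProd_flatten_of_mem_qsh z hπ]
        ring
      have t3 : ∀ π ∈ qsh (· ++ ·) S T, blockProd z (π ++ [A ++ B]).flatten =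
          blockProd z (S ++ [A]).flatten * blockProd z (T ++ [B]).flatten := fun π hπ => by
        simp only [List.flatten_append, List.flatten_cons, List.flatten_nil, List.append_nil,
          blockProd_append, blockProd_flatten_of_mem_qsh z hπ]
        ring
      rw [((qsh_concat_concat_perm (· ++ ·) A B S T).map (gfun z 1)).sum_eq, List.map_append,
        List.map_append, List.sum_append, List.sum_append, sum_map_gfun_concat z _ A _ t1,
        sum_map_gfun_concat z _ B _ t2, sum_map_gfun_concat z _ (A ++ B) _ t3,
        ← ihS (T ++ [B]) hS' hT, ← ihT hT', ← ihS T hS' hT', gfun_concat z A S, gfun_concat z B T,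
        one_mul, one_mul]
      linear_combination gfun z 1 S * gfun z 1 T * three_term ha1 hb1 hab

end Gfun

/-- **The registered stub `stub_stuffleComb`**: the five statements of `StuffleComb` —
`MZV.stuffle = qsh (+)`, hom-compatibility of `qsh`, coordinate conservation, preservation of
non-empty blocks, and the stuffle identity of the cubical generating functions on the open cube
(Hoffman 1997, §2–§3, in the cubical coordinates of the KZ calculus). -/
theorem stub_stuffleComb : StuffleComb :=
  ⟨stuffle_eq_qsh, fun op op' f hf u v => map_qsh op op' f hf u v,
    fun S T => flatten_perm_of_mem_qsh S T, fun S T hS hT => ne_nil_of_mem_qsh S T hS hT,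
    fun z hz S T hS hT => gfun_mul_gfun z hz S T hS hT⟩

end Summit.KontsevichZagierPeriods.MzvKernelInKZ.TwoPosets
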